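import Literature.Geometry.Lorentzian.Stationary
import Literature.Geometry.Manifold.ParametricIntervalIntegral
import Mathlib.Geometry.Manifold.PartitionOfUnity
import Mathlib.MeasureTheory.Integral.DominatedConvergence
import Mathlib.MeasureTheory.Integral.IntervalIntegral.FundThmCalculus
import HarnessLib

/-!
# Crux `HawkingExtensionIsKerr` (stmt-FinalStateConjecture-17840), line `SketchIdeator2` —
# programme TOP, brick SL-A: Wald's averaging trick (Chruściel–Costa 2008, Prop. 4.6)

Helper file of the line lead (c8) towards the registered stub `stub_top_slice`.  No Lorentzian
geometry is used: a smooth complete flow `θ : ℝ × M → M` on `M = 𝓑.carrier`, a CLOSED `θ`-invariant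
set `D` (later `doc ∪ 𝓔⁺`) and a function `t` continuous on `D` and EQUIVARIANT there,
`t (θ (s, x)) = t x + s` (later the time function of Chruściel–Costa 2008, Thm. 4.5).  Wald's
construction (CC08, Prop. 4.6: "`F(p) = ∫_{-∞}^0 f ∘ φ_s(p) ds` … increasing monotonically from zero
to infinity along every orbit … setting `S₁ = {F = T}` the result follows") gives (`top_wald`): a
smooth cut-off `f : M → [0, 1]`, `= 0` on `{t ≤ -1} ∩ D`, `= 1` on `{1 ≤ t} ∩ D`; the smooth averages
`G_N(y) = ∫_{-N}^0 f (θ (s, y)) ds` (`contMDiff_parametric_intervalIntegral`) with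
`d/dσ G_N(θ(σ, y))|₀ = f y - f (θ (-N, y))`; `F(y) = ∫_{-t(y)-2}^0 f (θ (s, y)) ds = G_N(y)` on
`{t ≤ N - 1} ∩ D`; and the crossing time `u` of the level `3` by the non-decreasing orbit profile
`σ ↦ F (θ (σ, y)) = ∫_{-t y - 2}^σ f (θ (v, y)) dv` (of slope `1` on `[1 - t y, ∞)`): unique,
`u y ∈ [1 - t y, 4 - t y]`, equivariant, CONTINUOUS on `D`, with `F (θ (u y + s, y)) = 3 + s` for `s ≥ 0`.
-/

noncomputable section

set_option linter.dupNamespace false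

namespace Summit.FinalStateConjecture.FinalStateConjecture.Theorems.HawkingExtensionIsKerr.SketchIdeator2

open Set Filter Function MeasureTheory intervalIntegral Literature.Geometry.Lorentzian
open scoped Manifold ContDiff Topology

/-- **FTC for a window integral.**  For a continuous `g : ℝ → ℝ`, the window integral
`σ ↦ ∫_{σ - N}^{σ} g` has derivative `g σ - g (σ - N)`. -/
theorem hasDerivAt_integral_window {g : ℝ → ℝ} (hg : Continuous g) (N σ : ℝ) :
    HasDerivAt (fun τ : ℝ ↦ ∫ v in (τ - N)..τ, g v) (g σ - g (σ - N)) σ := by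
  have hint : ∀ a b : ℝ, IntervalIntegrable g volume a b := fun a b ↦ hg.intervalIntegrable a b
  -- `∫_{τ-N}^τ g = ∫_0^τ g - ∫_0^{τ-N} g`
  have heq : (fun τ : ℝ ↦ ∫ v in (τ - N)..τ, g v) =
      fun τ ↦ (∫ v in (0:ℝ)..τ, g v) - ∫ v in (0:ℝ)..(τ - N), g v := by
    funext τ
    rw [integral_interval_sub_left (hint 0 τ) (hint 0 (τ - N))]
  rw [heq]
  have h1 : HasDerivAt (fun τ : ℝ ↦ ∫ v in (0:ℝ)..τ, g v) (g σ) σ :=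
    integral_hasDerivAt_right (hint 0 σ) (hg.stronglyMeasurableAtFilter _ _) hg.continuousAt
  have h2 : HasDerivAt (fun τ : ℝ ↦ ∫ v in (0:ℝ)..(τ - N), g v) (g (σ - N)) σ := by
    have h2a : HasDerivAt (fun τ : ℝ ↦ ∫ v in (0:ℝ)..τ, g v) (g (σ - N)) (σ - N) :=
      integral_hasDerivAt_right (hint 0 (σ - N)) (hg.stronglyMeasurableAtFilter _ _) hg.continuousAt
    have h2c := h2a.comp σ ((hasDerivAt_id σ).sub_const N)
    simp only [mul_one] at h2c
    exact h2c
  exact h1.sub h2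

/-- **The orbit profile of an integrand `g ∈ [0, 1]` which is `1` on `[c + 3, ∞)`**: `P σ := ∫_c^σ g`
is non-decreasing, `< 3` before `c + 3`, of slope `1` after `c + 3`; so the level `3` is taken exactly
once, at a point of `[c + 3, c + 6]`. -/
theorem orbitProfile_existsUnique {g : ℝ → ℝ} (hg : Continuous g) (hg0 : ∀ v, 0 ≤ g v)
    (hg1 : ∀ v, g v ≤ 1) {c : ℝ} (hhi : ∀ v, c + 3 ≤ v → g v = 1) :
    (∀ σ σ', σ ≤ σ' → (∫ v in c..σ, g v) ≤ ∫ v in c..σ', g v) ∧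
    (∀ σ, σ < c + 3 → (∫ v in c..σ, g v) < 3) ∧
    (∀ s, 0 ≤ s → (∫ v in c..(c + 3 + s), g v) = (∫ v in c..(c + 3), g v) + s) ∧
    (∃! σ, (∫ v in c..σ, g v) = 3) ∧
    (∀ σ, (∫ v in c..σ, g v) = 3 → c + 3 ≤ σ ∧ σ ≤ c + 6) := by
  have hint : ∀ a b : ℝ, IntervalIntegrable g volume a b := fun a b ↦ hg.intervalIntegrable a b
  -- monotonicity
  have hmono : ∀ σ σ', σ ≤ σ' → (∫ v in c..σ, g v) ≤ ∫ v in c..σ', g v := by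
    intro σ σ' h
    have : (∫ v in c..σ', g v) - ∫ v in c..σ, g v = ∫ v in σ..σ', g v :=
      integral_interval_sub_left (hint c σ') (hint c σ)
    have hnn : 0 ≤ ∫ v in σ..σ', g v := integral_nonneg h fun v _ ↦ hg0 v
    linarith
  -- upper bound `P σ ≤ σ - c` for `c ≤ σ`, and `P σ ≤ 0` for `σ ≤ c`
  have hub : ∀ σ, c ≤ σ → (∫ v in c..σ, g v) ≤ σ - c := by
    intro σ h
    calc (∫ v in c..σ, g v) ≤ ∫ _ in c..σ, (1:ℝ) :=
          integral_mono_on h (hint c σ) (by simp) fun v _ ↦ hg1 v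
      _ = σ - c := by simp
  have hneg : ∀ σ, σ ≤ c → (∫ v in c..σ, g v) ≤ 0 := by
    intro σ h
    rw [integral_symm]
    have : 0 ≤ ∫ v in σ..c, g v := integral_nonneg h fun v _ ↦ hg0 v
    linarith
  have hlt : ∀ σ, σ < c + 3 → (∫ v in c..σ, g v) < 3 := by
    intro σ h
    rcases le_or_gt c σ with hc | hc
    · exact lt_of_le_of_lt (hub σ hc) (by linarith)
    · exact lt_of_le_of_lt (hneg σ hc.le) (by norm_num)
  -- slope one beyond `c + 3`
  have hslope : ∀ s, 0 ≤ s → (∫ v in c..(c + 3 + s), g v) = (∫ v in c..(c + 3), g v) + s := by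
    intro s hs
    have hsub : (∫ v in c..(c + 3 + s), g v) - ∫ v in c..(c + 3), g v = ∫ v in (c + 3)..(c + 3 + s), g v :=
      integral_interval_sub_left (hint _ _) (hint _ _)
    have hone : ∫ v in (c + 3)..(c + 3 + s), g v = ∫ _ in (c + 3)..(c + 3 + s), (1:ℝ) := by
      apply integral_congr
      intro v hv
      rw [uIcc_of_le (by linarith)] at hv
      exact hhi v hv.1
    rw [hone, intervalIntegral.integral_const, smul_eq_mul, mul_one] at hsub
    linarith
  -- existence on `[c + 3, c + 6]`
  have hP3 : (∫ v in c..(c + 3), g v) ≤ 3 := by have := hub (c + 3) (by linarith); linarith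
  have hP6 : 3 ≤ ∫ v in c..(c + 6), g v := by
    have h := hslope 3 (by norm_num)
    have h0 : 0 ≤ ∫ v in c..(c + 3), g v := integral_nonneg (by linarith) fun v _ ↦ hg0 v
    rw [show c + 3 + 3 = c + 6 by ring] at h; linarith
  have hcont : Continuous fun σ ↦ ∫ v in c..σ, g v := continuous_primitive hint c
  obtain ⟨σ₀, hσ₀mem, hσ₀⟩ : ∃ σ₀ ∈ Icc (c + 3) (c + 6), (∫ v in c..σ₀, g v) = 3 :=
    intermediate_value_Icc (by linarith) hcont.continuousOn ⟨hP3, hP6⟩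
  -- any solution lies in `[c + 3, c + 6]`
  have hloc : ∀ σ, (∫ v in c..σ, g v) = 3 → c + 3 ≤ σ ∧ σ ≤ c + 6 := by
    intro σ hσ
    have h1 : c + 3 ≤ σ := by
      by_contra h
      exact (hlt σ (not_le.mp h)).ne hσ
    refine ⟨h1, ?_⟩
    by_contra h
    push Not at h
    have := hslope (σ - (c + 3)) (by linarith)
    rw [show c + 3 + (σ - (c + 3)) = σ by ring, hσ] at this
    have h6 := hslope 3 (by norm_num)
    rw [show c + 3 + 3 = c + 6 by ring] at h6
    have hm := hmono (c + 6) σ h.le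
    linarith
  -- uniqueness: two solutions are both `≥ c + 3`, where the slope is one
  have huniq : ∀ σ σ', (∫ v in c..σ, g v) = 3 → (∫ v in c..σ', g v) = 3 → σ = σ' := by
    intro σ σ' hσ hσ'
    have h1 := (hloc σ hσ).1
    have h2 := (hloc σ' hσ').1
    have e1 := hslope (σ - (c + 3)) (by linarith)
    have e2 := hslope (σ' - (c + 3)) (by linarith)
    rw [show c + 3 + (σ - (c + 3)) = σ by ring, hσ] at e1
    rw [show c + 3 + (σ' - (c + 3)) = σ' by ring, hσ'] at e2
    linarith
  exact ⟨hmono, hlt, hslope, ⟨σ₀, hσ₀, fun σ hσ ↦ huniq σ σ₀ hσ hσ₀⟩, hloc⟩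

/-- **Continuity of a transversal crossing time.**  Let `P : X → ℝ → ℝ` be a family of
non-decreasing functions, jointly continuous on `D × ℝ`, each taking the value `3` at exactly one
point `u x`, with `P x (u x + s) = 3 + s` for `s ≥ 0`.  Then `u` is continuous on `D`. -/
theorem continuousOn_crossing {X : Type*} [TopologicalSpace X] {D : Set X} {P : X → ℝ → ℝ}
    {u : X → ℝ} (hP : ContinuousOn (fun p : X × ℝ ↦ P p.1 p.2) (D ×ˢ univ))
    (hmono : ∀ x ∈ D, ∀ σ σ', σ ≤ σ' → P x σ ≤ P x σ')
    (hu : ∀ x ∈ D, P x (u x) = 3) (huniq : ∀ x ∈ D, ∀ σ, P x σ = 3 → σ = u x)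
    (hslope : ∀ x ∈ D, ∀ s, 0 ≤ s → P x (u x + s) = 3 + s) : ContinuousOn u D := by
  intro x₀ hx₀
  rw [ContinuousWithinAt, Metric.tendsto_nhds]
  intro ε hε
  -- strict inequalities at `x₀`
  have hplus : 3 < P x₀ (u x₀ + ε / 2) := by
    rw [hslope x₀ hx₀ (ε / 2) (by linarith)]; linarith
  have hminus : P x₀ (u x₀ - ε / 2) < 3 := by
    have hle : P x₀ (u x₀ - ε / 2) ≤ 3 := by
      rw [← hu x₀ hx₀]; exact hmono x₀ hx₀ _ _ (by linarith)
    refine lt_of_le_of_ne hle fun h ↦ ?_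
    have := huniq x₀ hx₀ _ h
    linarith
  -- they persist near `x₀` within `D`
  have hc : ∀ σ : ℝ, ContinuousWithinAt (fun x ↦ P x σ) D x₀ := by
    intro σ
    have h1 : ContinuousWithinAt (fun p : X × ℝ ↦ P p.1 p.2) (D ×ˢ univ) (x₀, σ) :=
      hP (x₀, σ) ⟨hx₀, mem_univ _⟩
    have h2 : ContinuousWithinAt (fun x : X ↦ (x, σ)) D x₀ :=
      (continuous_id.prodMk continuous_const).continuousWithinAt
    exact ContinuousWithinAt.comp (g := fun p : X × ℝ ↦ P p.1 p.2) (f := fun x : X ↦ (x, σ)) h1 h2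
      fun x hx ↦ ⟨hx, mem_univ _⟩
  have ev1 : ∀ᶠ x in 𝓝[D] x₀, 3 < P x (u x₀ + ε / 2) :=
    (hc _).eventually (isOpen_Ioi.mem_nhds hplus)
  have ev2 : ∀ᶠ x in 𝓝[D] x₀, P x (u x₀ - ε / 2) < 3 :=
    (hc _).eventually (isOpen_Iio.mem_nhds hminus)
  have ev3 : ∀ᶠ x in 𝓝[D] x₀, x ∈ D := eventually_mem_nhdsWithin
  filter_upwards [ev1, ev2, ev3] with x h1 h2 hxD
  -- the unique crossing of `P x` lies strictly between `u x₀ - ε/2` and `u x₀ + ε/2`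
  have hlow : u x₀ - ε / 2 < u x := by
    by_contra h
    push Not at h
    have := hmono x hxD _ _ h
    rw [hu x hxD] at this
    linarith
  have hhigh : u x < u x₀ + ε / 2 := by
    by_contra h
    push Not at h
    have := hmono x hxD _ _ h
    rw [hu x hxD] at this
    linarith
  rw [Real.dist_eq, abs_lt]
  constructor <;> linarith

set_option backward.isDefEq.respectTransparency false in
/-- **Chain rule: a spacetime curve followed by a real function** (the real-valued twin of c7's
`hasDerivAt_comp_of_hasMFDerivAt`, …SECChartLines.lean): if `γ` has velocity `v` at `t` and
`f : M → ℝ` is differentiable at `γ t`, then `f ∘ γ` has derivative `df (v)` at `t`. -/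
theorem hasDerivAt_comp_of_hasMFDerivAt_real {𝓑 : StationaryAFBlackHole.{0}} {f : 𝓑.carrier → ℝ}
    (γ : ℝ → 𝓑.carrier) {t : ℝ} {v : TangentSpace (𝓡 4) (γ t)} {u : ℝ}
    (hγ : HasMFDerivAt 𝓘(ℝ, ℝ) (𝓡 4) γ t ((1 : ℝ →L[ℝ] ℝ).smulRight v))
    (hf : MDifferentiableAt (𝓡 4) 𝓘(ℝ, ℝ) f (γ t))
    (hu : mfderiv (𝓡 4) 𝓘(ℝ, ℝ) f (γ t) v = u) : HasDerivAt (f ∘ γ) u t := by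
  subst hu
  rw [hasDerivAt_iff_hasFDerivAt, ← hasMFDerivAt_iff_hasFDerivAt]
  apply (hf.hasMFDerivAt.comp t hγ).congr_mfderiv
  refine ContinuousLinearMap.ext fun a : ℝ => ?_
  change (mfderiv (𝓡 4) 𝓘(ℝ, ℝ) f (γ t)) (((1 : ℝ →L[ℝ] ℝ) a) • v) =
    a • (mfderiv (𝓡 4) 𝓘(ℝ, ℝ) f (γ t)) v
  rw [map_smul]
  rfl

/-- **SL-A: Wald's averaging trick (Chruściel–Costa 2008, Prop. 4.6), the functions.**  See the
module docstring.  Inputs: a smooth complete flow `θ` on `𝓑.carrier` whose orbits are the integral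
curves of the stationary Killing field, a closed `θ`-invariant set `D`, and a function `t`
continuous and `θ`-equivariant on `D`.  Outputs: the cut-off `f`, the averaged function `F`
(locally on `D` the smooth `G_N = ∫_{-N}^0 f ∘ θ_s ds`, whose derivative along the field is
`f - f ∘ θ_{-N}`), and the continuous equivariant crossing time `u` of the level `3`. -/
theorem top_wald (𝓑 : StationaryAFBlackHole.{0}) (D : Set 𝓑.carrier) (hD : IsClosed D)
    (θ : ℝ × 𝓑.carrier → 𝓑.carrier) (hθs : ContMDiff (𝓘(ℝ, ℝ).prod (𝓡 4)) (𝓡 4) ∞ θ)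
    (hθ0 : ∀ p, θ (0, p) = p) (hθadd : ∀ a b p, θ (a, θ (b, p)) = θ (a + b, p))
    (hθX : ∀ p, IsMIntegralCurve (fun s ↦ θ (s, p)) 𝓑.killing)
    (hθD : ∀ s, ∀ x ∈ D, θ (s, x) ∈ D)
    (t : 𝓑.carrier → ℝ) (ht : ContinuousOn t D) (hteq : ∀ x ∈ D, ∀ s, t (θ (s, x)) = t x + s) :
    ∃ (f F u : 𝓑.carrier → ℝ),
      ContMDiff (𝓡 4) 𝓘(ℝ, ℝ) ∞ f ∧ (∀ y, f y ∈ Icc (0:ℝ) 1) ∧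
      (∀ y ∈ D, 1 ≤ t y → f y = 1) ∧ (∀ y ∈ D, t y ≤ -1 → f y = 0) ∧
      (∀ N : ℝ, ContMDiff (𝓡 4) 𝓘(ℝ, ℝ) ∞ (fun y ↦ ∫ s in (-N)..0, f (θ (s, y)))) ∧
      (∀ (N : ℝ) (y : 𝓑.carrier),
        HasDerivAt (fun σ : ℝ ↦ ∫ s in (-N)..0, f (θ (s, θ (σ, y)))) (f y - f (θ (-N, y))) 0) ∧
      (∀ (N : ℝ) (y : 𝓑.carrier), mfderiv (𝓡 4) 𝓘(ℝ, ℝ) (fun y ↦ ∫ s in (-N)..0, f (θ (s, y)))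
        (θ (0, y)) (𝓑.killing (θ (0, y))) = f y - f (θ (-N, y))) ∧
      (∀ y ∈ D, ∀ N : ℝ, t y + 1 ≤ N → F y = ∫ s in (-N)..0, f (θ (s, y))) ∧
      ContinuousOn F D ∧ ContinuousOn u D ∧
      (∀ y ∈ D, ∀ s, F (θ (s, y)) = 3 ↔ s = u y) ∧
      (∀ y ∈ D, ∀ s, u (θ (s, y)) = u y - s) ∧
      (∀ y ∈ D, 1 - t y ≤ u y ∧ u y ≤ 4 - t y) ∧
      (∀ y ∈ D, ∀ s, 0 ≤ s → F (θ (u y + s, y)) = 3 + s) := by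
  -- ## topology of the carrier
  haveI : LocallyCompactSpace 𝓑.carrier := Manifold.locallyCompact_of_finiteDimensional (I := 𝓡 4)
  haveI : SigmaCompactSpace 𝓑.carrier := sigmaCompactSpace_of_locallyCompact_secondCountable
  have hθc : Continuous θ := hθs.continuous
  -- ## the cut-off `f`
  have hA : IsClosed (D ∩ t ⁻¹' Iic (-1)) := ht.preimage_isClosed_of_isClosed hD isClosed_Iic
  have hB : IsClosed (D ∩ t ⁻¹' Ici 1) := ht.preimage_isClosed_of_isClosed hD isClosed_Ici
  have hAB : Disjoint (D ∩ t ⁻¹' Iic (-1)) (D ∩ t ⁻¹' Ici 1) := by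
    rw [Set.disjoint_left]
    rintro x ⟨-, hx⟩ ⟨-, hx'⟩
    simp only [mem_preimage, mem_Iic, mem_Ici] at hx hx'
    linarith
  obtain ⟨fb, hf0, hf1, hf01⟩ :=
    exists_contMDiffMap_zero_one_of_isClosed (I := 𝓡 4) (n := (⊤ : ℕ∞)) hA hB hAB
  set f : 𝓑.carrier → ℝ := ⇑fb with hfdef
  have hfs : ContMDiff (𝓡 4) 𝓘(ℝ, ℝ) ∞ f := fb.contMDiff
  have hfc : Continuous f := hfs.continuous
  have hfA : ∀ y ∈ D, t y ≤ -1 → f y = 0 := fun y hy h ↦ hf0 ⟨hy, h⟩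
  have hfB : ∀ y ∈ D, 1 ≤ t y → f y = 1 := fun y hy h ↦ hf1 ⟨hy, h⟩
  have hfI : ∀ y, f y ∈ Icc (0:ℝ) 1 := hf01
  -- ## the averages `G_N`
  have hG : ∀ N : ℝ, ContMDiff (𝓡 4) 𝓘(ℝ, ℝ) ∞ (fun y ↦ ∫ s in (-N)..0, f (θ (s, y))) := by
    intro N
    have hΦ : ContMDiff ((𝓡 4).prod 𝓘(ℝ, ℝ)) 𝓘(ℝ, ℝ) ∞ fun p : 𝓑.carrier × ℝ ↦ f (θ (p.2, p.1)) :=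
      hfs.comp (hθs.comp (contMDiff_snd.prodMk contMDiff_fst))
    exact Literature.Geometry.Manifold.contMDiff_parametric_intervalIntegral (J := 𝓡 4) hΦ (-N) 0
  -- orbit integrands
  have hgc : ∀ y, Continuous fun v : ℝ ↦ f (θ (v, y)) := fun y ↦
    hfc.comp (hθc.comp (continuous_id.prodMk continuous_const))
  -- ## derivative of `G_N` along the flow
  have hderiv : ∀ (N : ℝ) (y : 𝓑.carrier),
      HasDerivAt (fun σ : ℝ ↦ ∫ s in (-N)..0, f (θ (s, θ (σ, y)))) (f y - f (θ (-N, y))) 0 := by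
    intro N y
    have heq : (fun σ : ℝ ↦ ∫ s in (-N)..0, f (θ (s, θ (σ, y)))) =
        fun σ ↦ ∫ v in (σ - N)..σ, f (θ (v, y)) := by
      funext σ
      have : (fun s ↦ f (θ (s, θ (σ, y)))) = fun s ↦ f (θ (s + σ, y)) := by
        funext s; rw [hθadd]
      rw [this, integral_comp_add_right (fun v ↦ f (θ (v, y))) σ]
      congr 1 <;> ring
    rw [heq]
    exact (hasDerivAt_integral_window (hgc y) N 0).congr_deriv (by simp [hθ0])
  -- ## the same as an `mfderiv`
  have hmf : ∀ (N : ℝ) (y : 𝓑.carrier), mfderiv (𝓡 4) 𝓘(ℝ, ℝ) (fun y ↦ ∫ s in (-N)..0, f (θ (s, y)))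
      (θ (0, y)) (𝓑.killing (θ (0, y))) = f y - f (θ (-N, y)) := by
    intro N y
    set G : 𝓑.carrier → ℝ := fun y ↦ ∫ s in (-N)..0, f (θ (s, y)) with hGdef
    have hγ : HasMFDerivAt 𝓘(ℝ, ℝ) (𝓡 4) (fun s ↦ θ (s, y)) 0
        ((1 : ℝ →L[ℝ] ℝ).smulRight (𝓑.killing (θ (0, y)))) := hθX y 0
    have hGd : MDifferentiableAt (𝓡 4) 𝓘(ℝ, ℝ) G (θ (0, y)) :=
      ((hG N).contMDiffAt).mdifferentiableAt (by simp)
    have h4 : HasDerivAt (G ∘ fun s ↦ θ (s, y))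
        (mfderiv (𝓡 4) 𝓘(ℝ, ℝ) G (θ (0, y)) (𝓑.killing (θ (0, y)))) 0 :=
      hasDerivAt_comp_of_hasMFDerivAt_real (f := G) (fun s ↦ θ (s, y)) hγ hGd rfl
    exact h4.unique (hderiv N y)
  -- ## orbit integrands vanish early and equal one late
  have hg0 : ∀ y ∈ D, ∀ v, v ≤ -t y - 1 → f (θ (v, y)) = 0 := by
    intro y hy v hv
    apply hfA _ (hθD v y hy)
    rw [hteq y hy]; linarith
  have hg1 : ∀ y ∈ D, ∀ v, -t y - 2 + 3 ≤ v → f (θ (v, y)) = 1 := by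
    intro y hy v hv
    apply hfB _ (hθD v y hy)
    rw [hteq y hy]; linarith
  have hint : ∀ y (a b : ℝ), IntervalIntegrable (fun v ↦ f (θ (v, y))) volume a b :=
    fun y a b ↦ (hgc y).intervalIntegrable a b
  -- ## `F` and its agreement with `G_N`
  set F : 𝓑.carrier → ℝ := fun y ↦ ∫ s in (-t y - 2)..0, f (θ (s, y)) with hFdef
  have hFG : ∀ y ∈ D, ∀ N : ℝ, t y + 1 ≤ N → F y = ∫ s in (-N)..0, f (θ (s, y)) := by
    intro y hy N hN
    have hsplit := integral_add_adjacent_intervals (hint y (-N) (-t y - 2)) (hint y (-t y - 2) 0)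
    have hzero : ∫ s in (-N)..(-t y - 2), f (θ (s, y)) = 0 := by
      rw [integral_congr (g := fun _ ↦ (0:ℝ)) ?_]
      · simp
      · intro v hv
        have hv' : v ≤ -t y - 1 := by
          rcases mem_uIcc.mp hv with h | h
          · linarith [h.2]
          · linarith [h.2]
        exact hg0 y hy v hv'
    rw [hzero, zero_add] at hsplit
    exact hsplit
  -- ## the orbit profile `σ ↦ F (θ (σ, y)) = ∫_{-t y - 2}^σ f (θ (v, y)) dv`
  have hprof : ∀ y ∈ D, ∀ σ, F (θ (σ, y)) = ∫ v in (-t y - 2)..σ, f (θ (v, y)) := by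
    intro y hy σ
    simp only [hFdef]
    rw [hteq y hy σ]
    have : (fun s ↦ f (θ (s, θ (σ, y)))) = fun s ↦ f (θ (s + σ, y)) := by
      funext s; rw [hθadd]
    rw [this, integral_comp_add_right (fun v ↦ f (θ (v, y))) σ]
    congr 1 <;> ring
  -- the profile facts, orbit by orbit
  have hP : ∀ y ∈ D, (∀ σ σ', σ ≤ σ' → (∫ v in (-t y - 2)..σ, f (θ (v, y))) ≤ ∫ v in (-t y - 2)..σ', f (θ (v, y))) ∧
      (∀ σ, σ < -t y - 2 + 3 → (∫ v in (-t y - 2)..σ, f (θ (v, y))) < 3) ∧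
      (∀ s, 0 ≤ s → (∫ v in (-t y - 2)..(-t y - 2 + 3 + s), f (θ (v, y))) =
        (∫ v in (-t y - 2)..(-t y - 2 + 3), f (θ (v, y))) + s) ∧
      (∃! σ, (∫ v in (-t y - 2)..σ, f (θ (v, y))) = 3) ∧
      (∀ σ, (∫ v in (-t y - 2)..σ, f (θ (v, y))) = 3 → -t y - 2 + 3 ≤ σ ∧ σ ≤ -t y - 2 + 6) :=
    fun y hy ↦ orbitProfile_existsUnique (hgc y) (fun v ↦ (hfI _).1) (fun v ↦ (hfI _).2) (hg1 y hy)
  -- ## the crossing time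
  classical
  set u : 𝓑.carrier → ℝ := fun y ↦ if hy : y ∈ D then Classical.choose (hP y hy).2.2.2.1.exists else 0
    with hudef
  have hu3 : ∀ y ∈ D, (∫ v in (-t y - 2)..(u y), f (θ (v, y))) = 3 := by
    intro y hy
    simp only [hudef, hy, ↓reduceDIte]
    exact Classical.choose_spec (hP y hy).2.2.2.1.exists
  have huniq : ∀ y ∈ D, ∀ σ, (∫ v in (-t y - 2)..σ, f (θ (v, y))) = 3 → σ = u y := by
    intro y hy σ hσ
    exact (hP y hy).2.2.2.1.unique hσ (hu3 y hy)
  have hubound : ∀ y ∈ D, 1 - t y ≤ u y ∧ u y ≤ 4 - t y := by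
    intro y hy
    have := (hP y hy).2.2.2.2 (u y) (hu3 y hy)
    constructor <;> linarith [this.1, this.2]
  have hslope : ∀ y ∈ D, ∀ s, 0 ≤ s → (∫ v in (-t y - 2)..(u y + s), f (θ (v, y))) = 3 + s := by
    intro y hy s hs
    have hlo := ((hP y hy).2.2.2.2 (u y) (hu3 y hy)).1
    have e1 := (hP y hy).2.2.1 (u y - (-t y - 2 + 3) + s) (by linarith)
    have e2 := (hP y hy).2.2.1 (u y - (-t y - 2 + 3)) (by linarith)
    rw [show -t y - 2 + 3 + (u y - (-t y - 2 + 3) + s) = u y + s by ring] at e1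
    rw [show -t y - 2 + 3 + (u y - (-t y - 2 + 3)) = u y by ring, hu3 y hy] at e2
    linarith
  -- ## continuity of `u` on `D`
  have hPc : ContinuousOn (fun p : 𝓑.carrier × ℝ ↦ ∫ v in (-t p.1 - 2)..p.2, f (θ (v, p.1))) (D ×ˢ univ) := by
    have hQ : Continuous fun p : 𝓑.carrier × ℝ ↦ ∫ v in (0:ℝ)..p.2, f (θ (v, p.1)) := by
      have hunc : Continuous (Function.uncurry fun (y : 𝓑.carrier) (v : ℝ) ↦ f (θ (v, y))) :=
        hfc.comp (hθc.comp (continuous_snd.prodMk continuous_fst))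
      exact continuous_parametric_primitive_of_continuous (μ := volume) (a₀ := (0:ℝ)) hunc
    have heq : ∀ p : 𝓑.carrier × ℝ, (∫ v in (-t p.1 - 2)..p.2, f (θ (v, p.1))) =
        (∫ v in (0:ℝ)..p.2, f (θ (v, p.1))) - ∫ v in (0:ℝ)..(-t p.1 - 2), f (θ (v, p.1)) := by
      intro p
      rw [integral_interval_sub_left (hint p.1 0 p.2) (hint p.1 0 (-t p.1 - 2))]
    have h2 : ContinuousOn (fun p : 𝓑.carrier × ℝ ↦ ∫ v in (0:ℝ)..(-t p.1 - 2), f (θ (v, p.1))) (D ×ˢ univ) := by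
      have ha : ContinuousOn (fun p : 𝓑.carrier × ℝ ↦ (p.1, -t p.1 - 2)) (D ×ˢ univ) := by
        refine continuous_fst.continuousOn.prodMk ?_
        have : ContinuousOn (fun p : 𝓑.carrier × ℝ ↦ t p.1) (D ×ˢ univ) :=
          ht.comp continuous_fst.continuousOn fun p hp ↦ hp.1
        exact (this.neg.sub continuousOn_const)
      exact hQ.comp_continuousOn ha
    simp_rw [heq]
    exact (hQ.continuousOn.sub h2)
  have huc : ContinuousOn u D :=
    continuousOn_crossing (P := fun y σ ↦ ∫ v in (-t y - 2)..σ, f (θ (v, y))) hPc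
      (fun y hy ↦ (hP y hy).1) hu3 huniq hslope
  -- ## continuity of `F` on `D`
  have hFc : ContinuousOn F D := by
    have : ContinuousOn (fun y ↦ (y, (0:ℝ))) D := (continuous_id.prodMk continuous_const).continuousOn
    have h := hPc.comp this fun y hy ↦ ⟨hy, mem_univ _⟩
    exact h.congr fun y _ ↦ rfl
  -- ## assemble
  refine ⟨f, F, u, hfs, hfI, hfB, hfA, hG, hderiv, hmf, hFG, hFc, huc, ?_, ?_, hubound, ?_⟩
  · intro y hy s
    rw [hprof y hy]
    exact ⟨huniq y hy s, fun h ↦ h ▸ hu3 y hy⟩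
  · intro y hy s
    have hy' : θ (s, y) ∈ D := hθD s y hy
    symm
    apply huniq _ hy'
    rw [← hprof _ hy', hθadd, show u y - s + s = u y by ring, hprof y hy]
    exact hu3 y hy
  · intro y hy s hs
    rw [hprof y hy]
    exact hslope y hy s hs

end Summit.FinalStateConjecture.FinalStateConjecture.Theorems.HawkingExtensionIsKerr.SketchIdeator2

end
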